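import Mathlib
import HarnessLib

/-!
# `p`-adic accumulation of rational divisibilities along a convergent sequence of fibres — part 1: double coefficients `co`, Theorem A (closedness of `π^ℕ·units`), `finite_pow_dvd_of_dvr`, the evaluation calculus `evAt`/`EvAt`
# (cell `bsd-eis`, crux 4 `BSDpOnCellC` stmt-BirchSwinnertonDyer-19034, line «accum» — the ACCUMULATION LEVER behind the registered stub
# `stub_twoVarRatDivPNew` (crystal v7+); mathematics and Lean text by ideator bsd-idea-12 g15, `HOME pub/ideators/bsd-idea-12/bc/AccumHelpers.lean`
# sha16 d22ccc6e94281a99 = §0a of `Cruxes/BSDpOnCellC/Lines/accum.lean` v1.5, sorry-free, Mathlib-only; critic idea-crit-14 V99 N2 asked for it to be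
# landed as a built module; landed VERBATIM (split into 4 files ≤ 400 l.; part 1/4) by the LEAD cruxlead-19034 g0, `--supports -19034`)

HONEST FRAMING: pure commutative algebra over Mathlib (power series over a complete DVR; Weierstrass division by `X − x`; `π`-adic limits); standard
axioms, no `sorry`, no instance, no notation; nothing about any curve, Selmer group or `L`-function is asserted. It is the INTENDED PROOF MACHINERY of
the stub (member-wise rational divisibilities at the good crystalline members of a Hida branch ACCUMULATE `p`-adically to the `p`-new fibre), not a
proof of the stub: the member inputs and the fibre control remain. Contents of the whole module (source docstring):

# `p`-adic accumulation of rational divisibilities along a convergent sequence of fibres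
(helper module candidate; pure commutative algebra over Mathlib; standard axioms; no `sorry`)

Source: ideator `bsd-idea-12` g15, line «accum» on crux `BSDpOnCellC` (stmt-BirchSwinnertonDyer-19034), where §0a of
`Summits/BirchSwinnertonDyer/BirchSwinnertonDyer/Cruxes/BSDpOnCellC/Lines/accum.lean` (v1.5) carries the same declarations
inside the crux namespace. Critic idea-crit-14 VERDICT #99 N2 asked that this algebra be landed as a built helper module by a
prover/LEAD (`ledger propose … --supports stmt-BirchSwinnertonDyer-19034 --as helper`); this file is the ready source.

SETTING. `𝒪` a complete DVR (in the application `ℤ_p`), `R := 𝒪⟦X⟧⟦T₂⟧⟦T₁⟧` (as `PowerSeries (PowerSeries (PowerSeries 𝒪))`,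
innermost variable `X`), fibre ring `S := 𝒪⟦T₂⟧⟦T₁⟧`, `[X − y] := C (C (X − C y))`.

CONTENTS.
* `co`, `co_C_C_mul`, `eq_zero_of_co_eq_zero` — double coefficients.
* Theorem A `exists_eq_C_C_pow_mul_unit_of_coeff_adic_limit` — closedness of `π^ℕ·(units)` in `S` under coefficientwise
  `π`-adic convergence uniform in the index; `finite_pow_dvd_of_dvr`.
* Evaluation calculus `evAt` / `EvAt` at a point of the maximal ideal = Weierstrass division by the degree-one distinguished
  polynomial `X − x` (`Polynomial.IsDistinguishedAt.algEquivQuotient`, `Polynomial.quotientSpanXSubCAlgEquiv`): `evAt_C`,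
  `evAt_X`, `evAt_eq_zero_iff` (kernel `= (X − C x)`), `sub_dvd_evAt_sub_evAt`, `EvAt_C_C`, `co_EvAt`,
  `C_C_dvd_of_EvAt_eq_zero`, `EvAt_lift`.
* Theorem U₁ `not_dvd_of_uniform_members` — uniform member constant and `[X − x_∞] ∤ L` ⟹ `[X − x_∞] ∤ F`.
* Solving lemma `exists_mul_eq_of_forall_exists_mod` — `A·Z ≡ B (mod π^m)` solvable in `S` for all `m` ⟹ `A·Z = B` solvable
  (content decomposition; a unit-content series is a non-zero-divisor modulo every `π^m` because `(𝒪/π)⟦T₂⟧⟦T₁⟧` is a domain —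
  `C_C_dvd_of_dvd_mul`, `C_C_pow_dvd_of_dvd_mul`; Cauchy + `IsPrecomplete`).
* Theorem U₂ `dvd_limit_of_uniform_members`, `uniform_variant_holds` — the uniform-constant accumulation lemma.
* Content decomposition `exists_eq_C_C_pow_mul_not_dvd`; Theorem P `dvd_limit_of_members` — the accumulation lemma with
  VARYING member constants: `∀ k, p^{c_k}·L ∈ (F, [X − x_k])`, `x_k → x_∞` `p`-adically, `[X − x_∞] ∤ F` ⟹
  `∃ a, p^a·L ∈ (F, [X − x_∞])` (no unique factorisation used).
* Consumer schema `C_C_pow_mul_limit_mem_of_members` / `C_C_pow_mul_limit_mem_of_uniform_members` — an ideal `I ∋ p^m·F(x_∞)`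
  receives `p^{c'}·L(x_∞)`.

[cite: BuyukbodukLei2020, App. A Prop. 25 (arXiv:2008.08411 p. 51: the exact, Zariski-infinite, uniform-constant, upward sibling
«a divisibility criterion in regular rings»)]
-/

set_option autoImplicit false
set_option linter.dupNamespace false

noncomputable section

namespace Summit.BirchSwinnertonDyer.BirchSwinnertonDyer.Theorems.AccumHelpers

open PowerSeries

variable {𝒪 : Type*} [CommRing 𝒪]

/-- coefficient `(i, j)` of a doubly nested power series: `T₁^i T₂^j`. -/
def co (i j : ℕ) (G : PowerSeries (PowerSeries 𝒪)) : 𝒪 := coeff j (coeff i G)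

/-- Helper `co_C_C_mul` of the accumulation lemma (line «accum» §0a; statement as displayed; pure commutative algebra). [folklore] -/
lemma co_C_C_mul (c : 𝒪) (i j : ℕ) (G : PowerSeries (PowerSeries 𝒪)) :
    co i j (C (C c) * G) = c * co i j G := by
  simp only [co, coeff_C_mul]

/-- Helper `eq_zero_of_co_eq_zero` of the accumulation lemma (line «accum» §0a; statement as displayed; pure commutative algebra). [folklore] -/
lemma eq_zero_of_co_eq_zero (G : PowerSeries (PowerSeries 𝒪)) (h : ∀ i j, co i j G = 0) : G = 0 := by
  refine PowerSeries.ext fun i => ?_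
  rw [map_zero]
  refine PowerSeries.ext fun j => ?_
  rw [map_zero]
  exact h i j

/-- Helper `co_zero_zero` of the accumulation lemma (line «accum» §0a; statement as displayed; pure commutative algebra). [folklore] -/
lemma co_zero_zero (G : PowerSeries (PowerSeries 𝒪)) :
    co 0 0 G = constantCoeff (constantCoeff G) := by
  simp only [co, coeff_zero_eq_constantCoeff_apply]

/-- **Theorem A (UFD-free half of the accumulation lemma).** In a local domain `𝒪` with a prime
`π` of finite multiplicity in every nonzero element: if `H_k = π^{a_k}·(unit)` in `𝒪⟦T₂⟧⟦T₁⟧` for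
all `k`, the `H_k` converge to `H_∞ ≠ 0` coefficientwise `π`-adically (uniformly in the coefficient
index), then `H_∞ = π^b·(unit)`. -/
theorem exists_eq_C_C_pow_mul_unit_of_coeff_adic_limit [IsDomain 𝒪] [IsLocalRing 𝒪]
    (π : 𝒪) (hπ : Prime π) (hfin : ∀ c : 𝒪, c ≠ 0 → ∃ n : ℕ, ¬ π ^ n ∣ c)
    (H : ℕ → PowerSeries (PowerSeries 𝒪)) (Hlim : PowerSeries (PowerSeries 𝒪)) (a : ℕ → ℕ)
    (hmem : ∀ k, ∃ u : PowerSeries (PowerSeries 𝒪), IsUnit u ∧ H k = C (C (π ^ a k)) * u)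
    (hconv : ∀ m : ℕ, ∀ᶠ k in Filter.atTop, ∀ i j, π ^ m ∣ co i j (H k) - co i j Hlim)
    (hne : Hlim ≠ 0) :
    ∃ (b : ℕ) (u : PowerSeries (PowerSeries 𝒪)), IsUnit u ∧ Hlim = C (C (π ^ b)) * u := by
  classical
  -- Step 1: a nonzero coefficient of `Hlim` and a power of `π` not dividing it.
  obtain ⟨i₀, j₀, hd⟩ : ∃ i j, co i j Hlim ≠ 0 := by
    by_contra hall
    push Not at hall
    exact hne (eq_zero_of_co_eq_zero Hlim hall)
  obtain ⟨B, hB⟩ := hfin _ hd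
  -- coefficients of the members are divisible by `π ^ a k`
  have hdiv : ∀ k i j, π ^ a k ∣ co i j (H k) := by
    intro k i j
    obtain ⟨u, -, hk⟩ := hmem k
    refine ⟨co i j u, ?_⟩
    rw [hk, co_C_C_mul]
  -- Step 2: eventually `a k < B`.
  have hlt : ∀ᶠ k in Filter.atTop, a k < B := by
    filter_upwards [hconv B] with k hk
    by_contra hge
    push Not at hge
    apply hB
    have h1 : π ^ B ∣ co i₀ j₀ (H k) := (pow_dvd_pow π hge).trans (hdiv k i₀ j₀)
    have h2 : π ^ B ∣ co i₀ j₀ (H k) - co i₀ j₀ Hlim := hk i₀ j₀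
    have := dvd_sub h1 h2
    simpa using this
  -- Step 3: pick one good `k`.
  obtain ⟨k, hkB, hk⟩ := (hlt.and (hconv B)).exists
  obtain ⟨uk, huk, hHk⟩ := hmem k
  set b := a k with hb
  -- every coefficient of `Hlim` is divisible by `π ^ b`
  have hcoef : ∀ i j, π ^ b ∣ co i j Hlim := by
    intro i j
    have h1 : π ^ b ∣ co i j (H k) := hdiv k i j
    have h2 : π ^ b ∣ co i j (H k) - co i j Hlim := (pow_dvd_pow π hkB.le).trans (hk i j)
    have := dvd_sub h1 h2
    simpa using this
  choose q hq using hcoef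
  -- the (0,0) coefficient of `Hlim` is `π ^ b` times a unit
  have hunit00 : IsUnit (q 0 0) := by
    -- `co 0 0 (H k) = π^b * e` with `e` a unit
    have hek : IsUnit (co 0 0 uk) := by
      rw [co_zero_zero]
      exact (huk.map (constantCoeff : PowerSeries (PowerSeries 𝒪) →+* PowerSeries 𝒪)).map
        (constantCoeff : PowerSeries 𝒪 →+* 𝒪)
    have hH00 : co 0 0 (H k) = π ^ b * co 0 0 uk := by rw [hHk, co_C_C_mul]
    -- `π ^ B ∣ co 0 0 (H k) - co 0 0 Hlim`, `B ≥ b + 1`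
    obtain ⟨t, ht⟩ : π ^ (b + 1) ∣ co 0 0 (H k) - co 0 0 Hlim :=
      (pow_dvd_pow π (Nat.succ_le_of_lt hkB)).trans (hk 0 0)
    -- so `π^b * q 0 0 = π^b * (co 0 0 uk - π * t)`
    have hπb : π ^ b ≠ 0 := pow_ne_zero _ hπ.ne_zero
    have hq00 : q 0 0 = co 0 0 uk - π * t := by
      apply mul_left_cancel₀ hπb
      rw [← hq 0 0, mul_sub, ← hH00, ← sub_sub_cancel (co 0 0 (H k)) (co 0 0 Hlim), ht]
      ring
    rw [hq00]
    -- unit minus an element of the maximal ideal is a unit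
    have hπmem : π * t ∈ IsLocalRing.maximalIdeal 𝒪 :=
      Ideal.mul_mem_right _ _ ((IsLocalRing.mem_maximalIdeal _).mpr hπ.not_unit)
    by_contra hnu
    have hmem' : co 0 0 uk - π * t ∈ IsLocalRing.maximalIdeal 𝒪 :=
      (IsLocalRing.mem_maximalIdeal _).mpr hnu
    have : co 0 0 uk ∈ IsLocalRing.maximalIdeal 𝒪 := by
      have := Ideal.add_mem _ hmem' hπmem
      simpa using this
    exact (IsLocalRing.mem_maximalIdeal _).mp this hek
  -- Step 4: assemble the unit
  refine ⟨b, PowerSeries.mk fun i => PowerSeries.mk fun j => q i j, ?_, ?_⟩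
  · rw [isUnit_iff_constantCoeff, isUnit_iff_constantCoeff]
    have : constantCoeff (constantCoeff (PowerSeries.mk fun i => PowerSeries.mk fun j => q i j)) =
        q 0 0 := by
      rw [← coeff_zero_eq_constantCoeff_apply]
      rw [show constantCoeff (PowerSeries.mk fun i => PowerSeries.mk fun j => q i j) =
          coeff 0 (PowerSeries.mk fun i => PowerSeries.mk fun j => q i j) from
        (coeff_zero_eq_constantCoeff_apply _).symm]
      simp only [coeff_mk]
    rw [this]
    exact hunit00
  · refine PowerSeries.ext fun i => ?_
    rw [show coeff i (C (C (π ^ b)) * PowerSeries.mk fun i => PowerSeries.mk fun j => q i j) =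
        C (π ^ b) * coeff i (PowerSeries.mk fun i => PowerSeries.mk fun j => q i j) from
      coeff_C_mul _ _ _]
    refine PowerSeries.ext fun j => ?_
    rw [coeff_C_mul]
    simp only [coeff_mk]
    exact hq i j

/-- The finiteness hypothesis holds in a discrete valuation ring for an irreducible `p`. -/
theorem finite_pow_dvd_of_dvr [IsDomain 𝒪] [IsDiscreteValuationRing 𝒪] (π : 𝒪) (hπ : Irreducible π)
    (c : 𝒪) (hc : c ≠ 0) : ∃ n : ℕ, ¬ π ^ n ∣ c := by
  have hprime : Prime π := hπ.prime
  obtain ⟨n, hn⟩ := FiniteMultiplicity.of_prime_left hprime hc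
  exact ⟨n + 1, hn⟩


/-! ### Evaluation at a point of the maximal ideal (Weierstrass division by `X − x`) -/

section Eval

variable {𝒪 : Type*} [CommRing 𝒪] [IsLocalRing 𝒪] [IsAdicComplete (IsLocalRing.maximalIdeal 𝒪) 𝒪]

omit [IsAdicComplete (IsLocalRing.maximalIdeal 𝒪) 𝒪] in
/-- Helper `isDistinguishedAt_X_sub_C` of the accumulation lemma (line «accum» §0a; statement as displayed; pure commutative algebra). [folklore] -/
lemma isDistinguishedAt_X_sub_C {x : 𝒪} (hx : x ∈ IsLocalRing.maximalIdeal 𝒪) :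
    (Polynomial.X - Polynomial.C x).IsDistinguishedAt (IsLocalRing.maximalIdeal 𝒪) where
  mem := by
    intro n hn
    rw [Polynomial.natDegree_X_sub_C] at hn
    have hn0 : n = 0 := by omega
    subst hn0
    simp only [Polynomial.coeff_sub, Polynomial.coeff_X_zero, Polynomial.coeff_C_zero, zero_sub]
    exact neg_mem hx
  monic := Polynomial.monic_X_sub_C x

omit [IsLocalRing 𝒪] [IsAdicComplete (IsLocalRing.maximalIdeal 𝒪) 𝒪] in
/-- Helper `coe_X_sub_C` of the accumulation lemma (line «accum» §0a; statement as displayed; pure commutative algebra). [folklore] -/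
lemma coe_X_sub_C (x : 𝒪) :
    ((Polynomial.X - Polynomial.C x : Polynomial 𝒪) : PowerSeries 𝒪) =
      PowerSeries.X - PowerSeries.C x := by
  rw [← Polynomial.coeToPowerSeries.ringHom_apply, map_sub, Polynomial.coeToPowerSeries.ringHom_apply,
    Polynomial.coeToPowerSeries.ringHom_apply, Polynomial.coe_X, Polynomial.coe_C]

/-- `ev_x : 𝒪⟦X⟧ →ₐ[𝒪] 𝒪`, evaluation at `x ∈ 𝔪` (the remainder of Weierstrass division by `X − x`). -/
def evAt (x : 𝒪) (hx : x ∈ IsLocalRing.maximalIdeal 𝒪) : PowerSeries 𝒪 →ₐ[𝒪] 𝒪 :=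
  ((Polynomial.quotientSpanXSubCAlgEquiv x).toAlgHom.comp
    (isDistinguishedAt_X_sub_C hx).algEquivQuotient.symm.toAlgHom).comp
    (Ideal.Quotient.mkₐ 𝒪 (Ideal.span {((Polynomial.X - Polynomial.C x : Polynomial 𝒪) : PowerSeries 𝒪)}))

/-- Helper `evAt_C` of the accumulation lemma (line «accum» §0a; statement as displayed; pure commutative algebra). [folklore] -/
lemma evAt_C (x : 𝒪) (hx : x ∈ IsLocalRing.maximalIdeal 𝒪) (a : 𝒪) : evAt x hx (PowerSeries.C a) = a := by
  have := (evAt x hx).commutes a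
  rwa [← PowerSeries.C_eq_algebraMap] at this

/-- Helper `evAt_eq_zero_iff` of the accumulation lemma (line «accum» §0a; statement as displayed; pure commutative algebra). [folklore] -/
lemma evAt_eq_zero_iff (x : 𝒪) (hx : x ∈ IsLocalRing.maximalIdeal 𝒪) (f : PowerSeries 𝒪) :
    evAt x hx f = 0 ↔ (PowerSeries.X - PowerSeries.C x) ∣ f := by
  change (Polynomial.quotientSpanXSubCAlgEquiv x)
      ((isDistinguishedAt_X_sub_C hx).algEquivQuotient.symm (Ideal.Quotient.mk _ f)) = 0 ↔ _
  rw [EmbeddingLike.map_eq_zero_iff, EmbeddingLike.map_eq_zero_iff, Ideal.Quotient.eq_zero_iff_mem,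
    Ideal.mem_span_singleton, coe_X_sub_C]

/-- Helper `X_sub_C_dvd_sub_C_evAt` of the accumulation lemma (line «accum» §0a; statement as displayed; pure commutative algebra). [folklore] -/
lemma X_sub_C_dvd_sub_C_evAt (x : 𝒪) (hx : x ∈ IsLocalRing.maximalIdeal 𝒪) (f : PowerSeries 𝒪) :
    (PowerSeries.X - PowerSeries.C x) ∣ f - PowerSeries.C (evAt x hx f) := by
  rw [← evAt_eq_zero_iff x hx, map_sub, evAt_C, sub_self]

/-- Helper `evAt_X` of the accumulation lemma (line «accum» §0a; statement as displayed; pure commutative algebra). [folklore] -/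
lemma evAt_X (x : 𝒪) (hx : x ∈ IsLocalRing.maximalIdeal 𝒪) : evAt x hx PowerSeries.X = x := by
  have h : evAt x hx (PowerSeries.X - PowerSeries.C x) = 0 := (evAt_eq_zero_iff x hx _).mpr dvd_rfl
  rw [map_sub, evAt_C, sub_eq_zero] at h
  exact h

/-- two evaluations differ by a multiple of the difference of the points -/
lemma sub_dvd_evAt_sub_evAt (x y : 𝒪) (hx : x ∈ IsLocalRing.maximalIdeal 𝒪)
    (hy : y ∈ IsLocalRing.maximalIdeal 𝒪) (f : PowerSeries 𝒪) :
    (x - y) ∣ evAt x hx f - evAt y hy f := by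
  obtain ⟨q, hq⟩ := X_sub_C_dvd_sub_C_evAt y hy f
  have : f = PowerSeries.C (evAt y hy f) + (PowerSeries.X - PowerSeries.C y) * q := by
    rw [← hq]; ring
  have h2 : evAt x hx f = evAt y hy f + (x - y) * evAt x hx q := by
    conv_lhs => rw [this]
    rw [map_add, evAt_C, map_mul, map_sub, evAt_X, evAt_C]
  exact ⟨evAt x hx q, by rw [h2]; ring⟩

/-- coefficientwise evaluation `𝒪⟦X⟧⟦T₂⟧⟦T₁⟧ → 𝒪⟦T₂⟧⟦T₁⟧` -/
def EvAt (x : 𝒪) (hx : x ∈ IsLocalRing.maximalIdeal 𝒪) :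
    PowerSeries (PowerSeries (PowerSeries 𝒪)) →+* PowerSeries (PowerSeries 𝒪) :=
  PowerSeries.map (PowerSeries.map (evAt x hx).toRingHom)

/-- Helper `EvAt_C_C` of the accumulation lemma (line «accum» §0a; statement as displayed; pure commutative algebra). [folklore] -/
lemma EvAt_C_C (x : 𝒪) (hx : x ∈ IsLocalRing.maximalIdeal 𝒪) (c : PowerSeries 𝒪) :
    EvAt x hx (PowerSeries.C (PowerSeries.C c)) = PowerSeries.C (PowerSeries.C (evAt x hx c)) := by
  simp only [EvAt, PowerSeries.map_C]
  rfl

/-- Helper `co_EvAt` of the accumulation lemma (line «accum» §0a; statement as displayed; pure commutative algebra). [folklore] -/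
lemma co_EvAt (x : 𝒪) (hx : x ∈ IsLocalRing.maximalIdeal 𝒪) (i j : ℕ)
    (H : PowerSeries (PowerSeries (PowerSeries 𝒪))) :
    co i j (EvAt x hx H) = evAt x hx (coeff j (coeff i H)) := by
  simp only [co, EvAt, PowerSeries.coeff_map]
  rfl

/-- Helper `C_C_dvd_of_EvAt_eq_zero` of the accumulation lemma (line «accum» §0a; statement as displayed; pure commutative algebra). [folklore] -/
lemma C_C_dvd_of_EvAt_eq_zero (x : 𝒪) (hx : x ∈ IsLocalRing.maximalIdeal 𝒪)
    (H : PowerSeries (PowerSeries (PowerSeries 𝒪))) (h : EvAt x hx H = 0) :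
    PowerSeries.C (PowerSeries.C (PowerSeries.X - PowerSeries.C x)) ∣ H := by
  have hc : ∀ i j, (PowerSeries.X - PowerSeries.C x) ∣ coeff j (coeff i H) := by
    intro i j
    rw [← evAt_eq_zero_iff x hx, ← co_EvAt, h]
    simp [co]
  choose q hq using hc
  refine ⟨PowerSeries.mk fun i => PowerSeries.mk fun j => q i j, ?_⟩
  refine PowerSeries.ext fun i => ?_
  rw [PowerSeries.coeff_C_mul]
  refine PowerSeries.ext fun j => ?_
  rw [PowerSeries.coeff_C_mul]
  simp only [PowerSeries.coeff_mk]
  exact hq i j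

end Eval

end Summit.BirchSwinnertonDyer.BirchSwinnertonDyer.Theorems.AccumHelpers

end
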